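import Literature.Computability.Cryptography.CryptoFoundationsOneWayFunctions
import Literature.Computability.Complexity.PlumbingBricks
import Literature.Computability.Complexity.TimeBoundsProofs
import Literature.Computability.Complexity.PairingMachines
import HarnessLib

/-!
# The Goldreich–Levin function `g(x, r) = (f(x), r)` is one-way (discharge of `isOneWay_glFun`)

Sibling proof file of `CryptoFoundationsOneWayFunctions.lean` (D-0014: the named fact
`def isOneWay_glFun : Prop` is discharged here as `theorem isOneWay_glFun_holds : isOneWay_glFun`).

**Source.** Goldreich, *Foundations of Cryptography I* (2001), §2.5.2, the remark right after the
statement of Theorem 2.5.2 (`g(x, r) = (f(x), r)`, `|x| = |r|`, `b(x, r) = ⟨x, r⟩ mod 2`): "Clearly,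
`g` is also strongly one-way. We point out that `g` maintains other properties of `f`, such as being
length-preserving and being one-to-one." No proof is printed; this file supplies the standard
one-query reduction. In the tree `g = glFun f` acts on the single string `z = x ++ r` split at
`⌊|z|/2⌋` and outputs the *concatenation* `f x ++ r`; the fact therefore carries the hypothesis
`IsLengthPreserving f` (as does `goldreich_levin`), under which the concatenation determines the
pair. (Without a length convention the concatenated form need not be one-way, so the hypothesis is
not cosmetic.)

**The reduction.** Let `A'` be a PPT inverter for `g`. For the parity `b ∈ {0, 1}` of the attacked
length `m = 2n + b` let `A_b` be the inverter for `f` that on `⟨1ⁿ, y⟩` with coins `r = r₁ r₂`,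
`|r₁| = n + b`, queries `A'` on `⟨1^{2n+b}, y r₁⟩` with coins `r₂` and outputs the first `n` bits of
the answer (`GLFunOW.adv`). If `A'` returns a `g`-preimage `z'` of `y r₁ = g(x r₁)` then `|z'| = 2n + b`
(`g` is length-preserving with `f`) and hence `f (z' ↾ n) = y`: every success of `A'` on `x r₁` with
coins `r₂` is a success of `A_b` on `x` with coins `r₁ r₂`, so, counting over
`{0,1}^{2n+b} × {0,1}^κ ≃ {0,1}ⁿ × {0,1}^{n+b+κ}`,
`Pr[A' inverts g on U_{2n+b}] ≤ Pr[A_b inverts f on U_n]` (`GLFunOW.invertProb_glFun_le`). Both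
`A_0`, `A_1` are PPT (`GLFunOW.adv_isPPT`: the run function is a pipeline of the plumbing bricks of
`PlumbingBricks.lean` around one call of `A'`; the coin budget `(n + b) + κ`, read off the input
length `|⟨1ⁿ, f x⟩| = 3n + 2`, is polynomially bounded), so both success probabilities are
negligible, and `m ↦ Pr[A' inverts g on U_m]` is negligible along `m = 2⌊m/2⌋ + (m mod 2)`
(`GLFunOW.superpolynomialDecay_of_halves`). Finally `g ∈ FP` (`GLFunOW.glFun_mem_FP`: halve the
length in unary with `Plumb.divModFn`, `takeFn`/`dropFn`, apply `f`, concatenate).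

In the tree's model of probabilistic machines (`RandAlg`: a coin budget `coinLen` depending on the
input length only) the number `κ = coinLen_{A'}(3(2n+b)+2)` of coins handed to `A'` is determined by
`n` because all queries of level `n` have the same length; no advice-in-the-coin-count device (as in
`YaoAmplification.lean`) is needed here.

## Main statements

* `GLFunOW.glFun_mem_FP`: `f ∈ FP → glFun f ∈ FP`;
* `GLFunOW.adv`, `GLFunOW.adv_isPPT`, `GLFunOW.invertProb_glFun_le`;
* `isOneWay_glFun_holds : isOneWay_glFun`.

## References

* O. Goldreich, *Foundations of Cryptography I: Basic Tools*, Cambridge University Press 2001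
  (online edn. 2004, doi:10.1017/CBO9780511721656), §2.5.2, remark after Thm. 2.5.2 (p. 65);
  Def. 2.2.1 (strong one-way functions); §1.3.2 (probabilistic polynomial time).
* O. Goldreich, L. A. Levin, *A hard-core predicate for all one-way functions*, STOC 1989, 25–32.
* S. Arora, B. Barak, *Computational Complexity: A Modern Approach*, CUP 2009, §0.1 (pairing),
  §1.3 (composition of polynomial-time machines), §7.1 (probabilistic machines with a random tape).
-/

namespace Literature.Computability.Cryptography

open Filter Asymptotics _root_.Computability Complexity Finset

namespace GLFunOW

open Complexity.Brick Complexity.Plumb Complexity.OracleCompose Polynomial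

/-! ### Small list lemmas -/

/-- `|1ⁿ| = n` (Mathlib's `unary_decode_encode_nat`, `unaryDecodeNat = List.length`). [folklore] -/
private theorem length_unaryEncodeNat (n : ℕ) : (unaryEncodeNat n).length = n := unary_decode_encode_nat n

/-- `1^{2n+b} = 1ⁿ (1ⁿ 1ᵇ)`. [folklore] -/
theorem unaryEncodeNat_two_mul_add (n b : ℕ) :
    unaryEncodeNat (2 * n + b) = unaryEncodeNat n ++ (unaryEncodeNat n ++ ones b) := by
  simp only [Complexity.unaryEncodeNat_eq_replicate, ones, List.replicate_append_replicate]
  congr 1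
  ring

/-- The Goldreich–Levin function of a length-preserving `f` is length-preserving:
`|g z| = ⌊|z|/2⌋ + (|z| - ⌊|z|/2⌋) = |z|`. [Goldreich 2001, §2.5.2 ("`g` maintains … being
length-preserving")] [cite: Goldreich2001, §2.5.2 (remark after Thm. 2.5.2)] -/
theorem length_glFun {f : List Bool → List Bool} (hl : IsLengthPreserving f) (z : List Bool) :
    (glFun f z).length = z.length := by
  rw [glFun, List.length_append, hl (z.take _), List.length_take, List.length_drop]
  omega

/-- On a string of length `2n + b`, `b ≤ 1`, the Goldreich–Levin function reads `g(x r) = f(x) r` with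
`|x| = n`. [Goldreich 2001, Thm. 2.5.2 (definition of `g`)] [folklore] -/
theorem glFun_eq_of_length {f : List Bool → List Bool} {n b : ℕ} (hb : b ≤ 1) {z : List Bool}
    (hz : z.length = 2 * n + b) : glFun f z = f (z.take n) ++ z.drop n := by
  have hhalf : z.length / 2 = n := by rw [hz]; omega
  simp only [glFun, hhalf]

/-- **Event inclusion of the reduction.** If `z'` is a `g`-preimage of `f(x) r₁` (`|x| = n`,
`|r₁| = n + b`, `b ≤ 1`, `f` length-preserving), then `|z'| = 2n + b` and the first `n` bits of `z'`
are an `f`-preimage of `f x`. [Goldreich 2001, §2.5.2] [folklore] -/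
theorem f_take_eq_of_glFun_eq {f : List Bool → List Bool} (hl : IsLengthPreserving f) {n b : ℕ}
    (hb : b ≤ 1) {x r₁ z' : List Bool} (hx : x.length = n) (hr : r₁.length = n + b)
    (h : glFun f z' = f x ++ r₁) : f (z'.take n) = f x := by
  have hlen : z'.length = 2 * n + b := by
    have h1 := congrArg List.length h
    rw [length_glFun hl, List.length_append, hl x, hx, hr] at h1
    omega
  rw [glFun_eq_of_length hb hlen] at h
  refine List.append_inj_left h ?_
  rw [hl (z'.take n), hl x, List.length_take, hx, hlen]
  omega

/-! ### `g ∈ FP` -/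

/-- `halfLenF z = 1^{⌊|z|/2⌋}`: the unary half-length (`Plumb.divModFn` by `1²`). [folklore] -/
noncomputable def halfLenF : List Bool → List Bool :=
  fstF ∘ divModFn ∘ fanoutFn (fun _ => ones 2) onesFn

/-- Value of `halfLenF`. [folklore] -/
@[simp] theorem halfLenF_apply (z : List Bool) : halfLenF z = ones (z.length / 2) := by
  have h : onesFn z = ones z.length := by simp [onesFn, Complexity.unaryEncodeNat_eq_replicate, ones]
  simp [halfLenF, h]

/-- `halfLenF ∈ FP`. [folklore] -/
theorem halfLenF_mem_FP : halfLenF ∈ FP :=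
  comp_mem_FP fstF_mem_FP (comp_mem_FP divModFn_mem_FP (fanoutFn_mem_FP (const_mem_FP _) onesFn_mem_FP))

/-- The Goldreich–Levin function as a brick pipeline: `⟨f (z ↾ h), z ⇂ h⟩ ↦ f (z ↾ h) ++ z ⇂ h`,
`h = ⌊|z|/2⌋`. [folklore] -/
noncomputable def glFunF (f : List Bool → List Bool) : List Bool → List Bool :=
  concatFn ∘ fanoutFn (f ∘ takeFn ∘ fanoutFn halfLenF id) (dropFn ∘ fanoutFn halfLenF id)

/-- The pipeline computes `glFun f`. [folklore] -/
theorem glFunF_eq (f : List Bool → List Bool) : glFunF f = glFun f := by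
  funext z
  simp [glFunF, glFun, ones]

/-- **`g` is polynomial-time computable** for polynomial-time `f` ("`g` maintains other properties
of `f`": efficiency). [Goldreich 2001, §2.5.2] [cite: Goldreich2001, §2.5.2 (remark after Thm. 2.5.2)] -/
theorem glFun_mem_FP {f : List Bool → List Bool} (hf : f ∈ FP) : glFun f ∈ FP := by
  rw [← glFunF_eq]
  exact comp_mem_FP concatFn_mem_FP (fanoutFn_mem_FP
    (comp_mem_FP hf (comp_mem_FP takeFn_mem_FP (fanoutFn_mem_FP halfLenF_mem_FP id_mem_FP)))
    (comp_mem_FP dropFn_mem_FP (fanoutFn_mem_FP halfLenF_mem_FP id_mem_FP)))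

/-! ### The inverter `A_b` for `f` -/

section Adversary

variable (A' : RandAlg (List Bool) (List Bool)) (b : ℕ)

/-- The query `⟨1^{2n+b}, y r₁⟩` handed to the `g`-inverter. [Goldreich 2001, §2.5.2] [folklore] -/
def query (n : ℕ) (y r₁ : List Bool) : List Bool :=
  boolPair (unaryEncodeNat (2 * n + b)) (y ++ r₁)

/-- **The run function of `A_b`**: on `⟨u, y⟩` (`n = |u|`) with coins `r`, query `A'` on
`⟨1^{2n+b}, y (r ↾ (n+b))⟩` with coins `r ⇂ (n+b)` and output the first `n` bits of the answer.
[Goldreich 2001, §2.5.2 (the evident reduction behind "Clearly, `g` is also strongly one-way")]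
[cite: Goldreich2001, §2.5.2 (remark after Thm. 2.5.2)] -/
def advRun (inp r : List Bool) : List Bool :=
  (A'.run (query b (boolUnpair inp).1.length (boolUnpair inp).2 (r.take ((boolUnpair inp).1.length + b)))
    (r.drop ((boolUnpair inp).1.length + b))).take (boolUnpair inp).1.length

/-- `A'`'s coin count on the queries of level `n` (all of length `3(2n+b) + 2`). [folklore] -/
def kap (n : ℕ) : ℕ := A'.coinLen (3 * (2 * n + b) + 2)

/-- **The coin budget of `A_b`** as a function of the input length `ℓ = |⟨1ⁿ, f x⟩| = 3n + 2`:
`(n + b) + κ(n)`, `n = (ℓ - 2)/3`, `κ = kap`. [folklore] -/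
def advCoinLen (ℓ : ℕ) : ℕ := ((ℓ - 2) / 3 + b) + kap A' b ((ℓ - 2) / 3)

/-- **The inverter `A_b`.** [Goldreich 2001, §2.5.2] [cite: Goldreich2001, §2.5.2 (remark after Thm. 2.5.2)] -/
def adv : RandAlg (List Bool) (List Bool) where
  run := advRun A' b
  coinLen := advCoinLen A' b

variable {A' b}

/-- Length of a query of level `n`. [folklore] -/
theorem length_query {n : ℕ} {y r₁ : List Bool} (hy : y.length = n) (hr : r₁.length = n + b) :
    (query b n y r₁).length = 3 * (2 * n + b) + 2 := by
  simp only [query, length_boolPair, length_unaryEncodeNat, List.length_append, hy, hr]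
  ring

/-- The budget on the honest input length `3n + 2`. [folklore] -/
theorem advCoinLen_eq (n : ℕ) : advCoinLen A' b (3 * n + 2) = (n + b) + kap A' b n := by
  have h : (3 * n + 2 - 2) / 3 = n := by omega
  simp only [advCoinLen, h]

/-- The run of `A_b` on a well-formed input `⟨1ⁿ, y⟩`. [folklore] -/
theorem advRun_boolPair (n : ℕ) (y r : List Bool) :
    advRun A' b (boolPair (unaryEncodeNat n) y) r =
      (A'.run (query b n y (r.take (n + b))) (r.drop (n + b))).take n := by
  simp only [advRun, boolUnpair_boolPair, length_unaryEncodeNat]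

/-! #### `A_b` is PPT: the run function as a brick pipeline on `⟨inp, r⟩` -/

/-- `1ⁿ`, `n = |(boolUnpair inp).1|`. [folklore] -/
noncomputable def uF : List Bool → List Bool := onesFn ∘ fstF ∘ fstF
/-- `1^{n+b}`. [folklore] -/
noncomputable def nbF (b : ℕ) : List Bool → List Bool := concatFn ∘ fanoutFn uF (fun _ => ones b)
/-- `1^{2n+b} = 1ⁿ 1^{n+b}`. [folklore] -/
noncomputable def mF (b : ℕ) : List Bool → List Bool := concatFn ∘ fanoutFn uF (nbF b)
/-- `r ↾ (n+b)`. [folklore] -/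
noncomputable def r1F (b : ℕ) : List Bool → List Bool := takeFn ∘ fanoutFn (nbF b) sndF
/-- `r ⇂ (n+b)`. [folklore] -/
noncomputable def r2F (b : ℕ) : List Bool → List Bool := dropFn ∘ fanoutFn (nbF b) sndF
/-- The query `⟨1^{2n+b}, y (r ↾ (n+b))⟩`. [folklore] -/
noncomputable def qF (b : ℕ) : List Bool → List Bool :=
  fanoutFn (mF b) (concatFn ∘ fanoutFn (sndF ∘ fstF) (r1F b))
/-- `A'` as a string function `⟨q, r₂⟩ ↦ A'(q; r₂)`. [folklore] -/
def bFn (A' : RandAlg (List Bool) (List Bool)) : List Bool → List Bool :=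
  Function.uncurry A'.run ∘ boolUnpair
/-- `A'`'s answer. [folklore] -/
noncomputable def zF (A' : RandAlg (List Bool) (List Bool)) (b : ℕ) : List Bool → List Bool :=
  bFn A' ∘ fanoutFn (qF b) (r2F b)
/-- **The whole run function on `⟨inp, r⟩`**: the first `n` bits of the answer. [folklore] -/
noncomputable def runF (A' : RandAlg (List Bool) (List Bool)) (b : ℕ) : List Bool → List Bool :=
  takeFn ∘ fanoutFn (fstF ∘ fstF) (zF A' b)

/-- **The pipeline computes the run function of `A_b`** (on every pair, well-formed or not: both
sides only read `boolUnpair inp`). [folklore] -/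
theorem runF_boolPair (inp r : List Bool) : runF A' b (boolPair inp r) = advRun A' b inp r := by
  have hu : uF (boolPair inp r) = unaryEncodeNat (boolUnpair inp).1.length := by
    simp [uF, fstF, onesFn]
  have hnb : nbF b (boolPair inp r) = unaryEncodeNat (boolUnpair inp).1.length ++ ones b := by
    simp [nbF, hu]
  have hlen : (unaryEncodeNat (boolUnpair inp).1.length ++ ones b).length = (boolUnpair inp).1.length + b := by
    simp [length_unaryEncodeNat, ones]
  have hm : mF b (boolPair inp r) = unaryEncodeNat (2 * (boolUnpair inp).1.length + b) := by
    simp [mF, hu, hnb, unaryEncodeNat_two_mul_add]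
  have hr1 : r1F b (boolPair inp r) = r.take ((boolUnpair inp).1.length + b) := by
    simp [r1F, hnb, hlen, sndF]
  have hr2 : r2F b (boolPair inp r) = r.drop ((boolUnpair inp).1.length + b) := by
    simp [r2F, hnb, hlen, sndF]
  have hq : qF b (boolPair inp r) =
      query b (boolUnpair inp).1.length (boolUnpair inp).2 (r.take ((boolUnpair inp).1.length + b)) := by
    simp [qF, hm, hr1, query, fstF, sndF]
  have hz : zF A' b (boolPair inp r) =
      A'.run (query b (boolUnpair inp).1.length (boolUnpair inp).2 (r.take ((boolUnpair inp).1.length + b)))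
        (r.drop ((boolUnpair inp).1.length + b)) := by
    simp [zF, bFn, hq, hr2]
  simp [runF, hz, advRun, fstF]

/-- `runF ∈ FP` for a PPT `A'`. [Arora–Barak 2009, §1.3 (composition)] [folklore] -/
theorem runF_mem_FP (b : ℕ) (hA : IsPPT A' id) : runF A' b ∈ FP := by
  have hu : uF ∈ FP := comp_mem_FP onesFn_mem_FP (comp_mem_FP fstF_mem_FP fstF_mem_FP)
  have hnb : nbF b ∈ FP := comp_mem_FP concatFn_mem_FP (fanoutFn_mem_FP hu (const_mem_FP _))
  have hm : mF b ∈ FP := comp_mem_FP concatFn_mem_FP (fanoutFn_mem_FP hu hnb)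
  have hr1 : r1F b ∈ FP := comp_mem_FP takeFn_mem_FP (fanoutFn_mem_FP hnb sndF_mem_FP)
  have hr2 : r2F b ∈ FP := comp_mem_FP dropFn_mem_FP (fanoutFn_mem_FP hnb sndF_mem_FP)
  have hq : qF b ∈ FP :=
    fanoutFn_mem_FP hm (comp_mem_FP concatFn_mem_FP (fanoutFn_mem_FP (comp_mem_FP sndF_mem_FP fstF_mem_FP) hr1))
  have hb : bFn A' ∈ FP := by
    show PolyTimeComputable id id (Function.uncurry A'.run ∘ boolUnpair)
    exact PolyTimeComputable.comp_holds hA.1 polyTimeComputable_boolUnpair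
  have hz : zF A' b ∈ FP := comp_mem_FP hb (fanoutFn_mem_FP hq hr2)
  exact comp_mem_FP takeFn_mem_FP (fanoutFn_mem_FP (comp_mem_FP fstF_mem_FP fstF_mem_FP) hz)

/-- The run function of `A_b` is polynomial-time on the pair presentation of (input, coins) (the
time core of `IsPPT`). [Goldreich 2001, §1.3.2; Arora–Barak 2009, §7.1] [folklore] -/
theorem advRun_polyTime (b : ℕ) (hA : IsPPT A' id) :
    PolyTimeComputable (fun p : List Bool × List Bool => boolPair (id p.1) p.2) id
      (Function.uncurry (advRun A' b)) := by
  obtain ⟨p, M, hM⟩ := runF_mem_FP (A' := A') b hA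
  refine ⟨p, M, fun q => ?_⟩
  have h := hM (boolPair q.1 q.2)
  rw [id, runF_boolPair] at h
  exact h

/-- Evaluation of an `ℕ`-polynomial is monotone (the tree's `TM2Iter.eval_mono`). [folklore] -/
private theorem natPoly_eval_mono (p : Polynomial ℕ) {x y : ℕ} (hxy : x ≤ y) : p.eval x ≤ p.eval y :=
  TM2Iter.eval_mono p hxy

/-- **`A_b` is PPT** for a PPT `A'`: polynomial-time run (`advRun_polyTime`) and the budget
`(n + b) + coinLen_{A'}(3(2n+b)+2) ≤ ℓ + b + q_{A'}(2ℓ + 3b + 2)`, `n = (ℓ-2)/3 ≤ ℓ`.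
[Goldreich 2001, §1.3.2] [folklore] -/
theorem adv_isPPT (b : ℕ) (hA : IsPPT A' id) : IsPPT (adv A' b) id := by
  refine ⟨advRun_polyTime b hA, ?_⟩
  obtain ⟨q, hq⟩ := hA.2
  refine ⟨X + C b + q.comp (C 2 * X + C (3 * b + 2)), fun ℓ => ?_⟩
  show (ℓ - 2) / 3 + b + A'.coinLen (3 * (2 * ((ℓ - 2) / 3) + b) + 2) ≤ _
  simp only [eval_add, eval_X, eval_C, eval_comp, eval_mul]
  have h1 : (ℓ - 2) / 3 ≤ ℓ := (Nat.div_le_self _ _).trans (Nat.sub_le _ _)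
  have h2 : 3 * (2 * ((ℓ - 2) / 3) + b) + 2 ≤ 2 * ℓ + (3 * b + 2) := by omega
  exact Nat.add_le_add (Nat.add_le_add_right h1 _) ((hq _).trans (natPoly_eval_mono q h2))

end Adversary

/-! ### Counting: a success of `A'` is a success of `A_b` -/

section Counting

/-- A `RandAlg` probability as a normalised count of coin strings (the `Finset` form of
`RandAlg.pr`; local twin of `Yao.Params.prCount_eq` / `RandAlg.pr_eq_card_filter_div`, whose files
are not imported here). [Arora–Barak 2009, §7.1] [folklore] -/
theorem pr_eq_card {α β : Type} (B : RandAlg α β) (ea : α → List Bool) (a : α) (E : Set β)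
    [DecidablePred (· ∈ E)] {k : ℕ} (hk : B.coinLen (ea a).length = k) :
    B.pr ea a E = ((univ.filter fun v : List.Vector Bool k => B.run a v.toList ∈ E).card : ℝ) / 2 ^ k := by
  classical
  subst hk
  unfold RandAlg.pr RandAlg.outputPMF
  rw [PMF.toOuterMeasure_map_apply, PMF.toOuterMeasure_uniformOfFintype_apply, card_vector, Fintype.card_bool,
    ENNReal.toReal_div]
  congr 1
  · norm_cast
    rw [Fintype.card_subtype]
    congr 1
    ext v
    simp
  · simp

/-- Reading a string of length `a + c` as two consecutive fields (private twin of `vecSplitEquiv`,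
`LiuPassPadding.lean`, not imported here). [folklore] -/
private def vecSplit (a c : ℕ) : List.Vector Bool (a + c) ≃ List.Vector Bool a × List.Vector Bool c where
  toFun v := (⟨v.toList.take a, by simp⟩, ⟨v.toList.drop a, by simp⟩)
  invFun q := q.1 ++ q.2
  left_inv v := by
    obtain ⟨l, hl⟩ := v
    exact Subtype.ext (List.take_append_drop a l)
  right_inv q := by
    obtain ⟨⟨u, hu⟩, ⟨w, hw⟩⟩ := q
    refine Prod.ext (Subtype.ext ?_) (Subtype.ext ?_)
    · show List.take a (u ++ w) = u
      exact List.take_left' hu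
    · show List.drop a (u ++ w) = w
      exact List.drop_left' hu

/-- Splitting a sum over `{0,1}^{a+c}` into iterated sums over the two fields (private twin of
`sum_vector_add`, `LiuPassPadding.lean` — a file downstream of this one in content, not imported; a
librarian hoist of the `uniformAvg` algebra into `StatisticalDistance.lean` is the intended end
state). [folklore] -/
private theorem sum_split {M : Type*} [AddCommMonoid M] (a c : ℕ) (φ : List Bool → List Bool → M) :
    ∑ v : List.Vector Bool (a + c), φ (v.toList.take a) (v.toList.drop a) =
      ∑ u : List.Vector Bool a, ∑ w : List.Vector Bool c, φ u.toList w.toList := by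
  rw [← Fintype.sum_prod_type' (f := fun (u : List.Vector Bool a) (w : List.Vector Bool c) => φ u.toList w.toList)]
  exact Fintype.sum_equiv (vecSplit a c) _ _ fun v => rfl

/-- The uniform average over `{0,1}^{a+c}` of a function of the two fields is the iterated average
(private twin of `uniformAvg_add`, `LiuPassPadding.lean`, not imported here). [folklore] -/
private theorem uniformAvg_split (a c : ℕ) (φ : List Bool → List Bool → ℝ) :
    uniformAvg (a + c) (fun x => φ (x.take a) (x.drop a)) = uniformAvg a fun u => uniformAvg c fun w => φ u w := by
  unfold uniformAvg
  rw [sum_split (M := ℝ) a c φ]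
  simp only [Finset.sum_div, div_div, pow_add]
  refine Finset.sum_congr rfl fun u _ => Finset.sum_congr rfl fun w _ => ?_
  rw [mul_comm]

/-- Counting an event on `{0,1}^{a+c}` fibrewise over the first field. [folklore] -/
private theorem card_filter_split (a c : ℕ) (P : List Bool → List Bool → Prop) [∀ u w, Decidable (P u w)] :
    ((univ.filter fun r : List.Vector Bool (a + c) => P (r.toList.take a) (r.toList.drop a)).card : ℝ) =
      ∑ u : List.Vector Bool a, ((univ.filter fun w : List.Vector Bool c => P u.toList w.toList).card : ℝ) := by
  rw [natCast_card_filter, sum_split (M := ℝ) a c (fun u w => if P u w then 1 else 0)]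
  refine Finset.sum_congr rfl fun u _ => ?_
  rw [natCast_card_filter]

/-- Uniform averages only see strings of the given length (private twin of `uniformAvg_congr`,
`LiuPassPadding.lean`, not imported here). [folklore] -/
private theorem uniformAvg_congr {m : ℕ} {F G : List Bool → ℝ} (h : ∀ x : List Bool, x.length = m → F x = G x) :
    uniformAvg m F = uniformAvg m G := by
  unfold uniformAvg
  congr 1
  exact Finset.sum_congr rfl fun x _ => h _ (by simp)

/-- Monotonicity of uniform averages, pointwise on strings of the given length (private twin of
`uniformAvg_mono`, `LiuPassLemma53Hiding.lean`, not imported here). [folklore] -/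
private theorem uniformAvg_mono {m : ℕ} {F G : List Bool → ℝ} (h : ∀ x : List Bool, x.length = m → F x ≤ G x) :
    uniformAvg m F ≤ uniformAvg m G := by
  unfold uniformAvg
  exact div_le_div_of_nonneg_right (Finset.sum_le_sum fun x _ => h _ (by simp)) (by positivity)

variable {A' : RandAlg (List Bool) (List Bool)} {b : ℕ} {f : List Bool → List Bool}

/-- **The pointwise comparison.** For `|x| = n`: averaged over `r₁ ← U_{n+b}`, the probability that
`A'` inverts `g` on `g(x r₁)` is at most the probability that `A_b` inverts `f` on `f x` (the coins
`r₁ r₂` of `A_b` enumerate the pairs (`r₁`, coins of `A'`), and successes map to successes,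
`f_take_eq_of_glFun_eq`). [Goldreich 2001, §2.5.2] [folklore] -/
theorem key_le (hl : IsLengthPreserving f) (hb : b ≤ 1) {n : ℕ} {x : List Bool} (hx : x.length = n) :
    uniformAvg (n + b) (fun r₁ => A'.pr id (query b n (f x) r₁) {z' | glFun f z' = f x ++ r₁}) ≤
      (adv A' b).pr id (boolPair (unaryEncodeNat n) (f x)) {w | f w = f x} := by
  have hfx : (f x).length = n := by rw [hl x, hx]
  -- the right-hand side as a count over `{0,1}^{(n+b)+κ}`, fibred over `r₁`
  have hc : (adv A' b).coinLen (id (boolPair (unaryEncodeNat n) (f x))).length = (n + b) + kap A' b n := by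
    have hlen : (id (boolPair (unaryEncodeNat n) (f x))).length = 3 * n + 2 := by
      simp only [id, length_boolPair, length_unaryEncodeNat, hfx]; ring
    rw [hlen]
    exact advCoinLen_eq n
  rw [pr_eq_card (adv A' b) id _ _ hc]
  rw [Finset.filter_congr (q := fun v : List.Vector Bool ((n + b) + kap A' b n) =>
      f ((A'.run (query b n (f x) (v.toList.take (n + b))) (v.toList.drop (n + b))).take n) = f x)
      (fun v _ => by simp only [Set.mem_setOf_eq, adv, advRun_boolPair]),
    card_filter_split (n + b) (kap A' b n) (fun r₁ r₂ => f ((A'.run (query b n (f x) r₁) r₂).take n) = f x)]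
  -- the left-hand side as counts over `{0,1}^κ`, one for each `r₁`
  have hlhs : ∑ u : List.Vector Bool (n + b), A'.pr id (query b n (f x) u.toList) {z' | glFun f z' = f x ++ u.toList} =
      ∑ u : List.Vector Bool (n + b), ((univ.filter fun w : List.Vector Bool (kap A' b n) =>
        glFun f (A'.run (query b n (f x) u.toList) w.toList) = f x ++ u.toList).card : ℝ) / 2 ^ (kap A' b n) := by
    refine Finset.sum_congr rfl fun u _ => ?_
    have hk : A'.coinLen (id (query b n (f x) u.toList)).length = kap A' b n := by
      rw [id, length_query hfx u.toList_length]; rfl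
    rw [pr_eq_card A' id _ _ hk]
    rfl
  simp only [uniformAvg]
  rw [hlhs, ← Finset.sum_div, div_div, pow_add (2 : ℝ) (n + b) (kap A' b n), mul_comm ((2 : ℝ) ^ (n + b))]
  refine div_le_div_of_nonneg_right ?_ (by positivity)
  refine Finset.sum_le_sum fun u _ => ?_
  exact_mod_cast card_le_card fun w hw => by
    simp only [mem_filter, mem_univ, true_and] at hw ⊢
    exact f_take_eq_of_glFun_eq hl hb hx u.toList_length hw

/-- **Success probabilities compare**: `Pr[A' inverts g on U_{2n+b}] ≤ Pr[A_b inverts f on U_n]`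
(`b ≤ 1`). [Goldreich 2001, §2.5.2 ("Clearly, `g` is also strongly one-way")]
[cite: Goldreich2001, §2.5.2 (remark after Thm. 2.5.2)] -/
theorem invertProb_glFun_le (A' : RandAlg (List Bool) (List Bool)) (hl : IsLengthPreserving f) (hb : b ≤ 1)
    (n : ℕ) : invertProb (glFun f) A' (2 * n + b) ≤ invertProb f (adv A' b) n := by
  have h1 : invertProb (glFun f) A' (2 * n + b) =
      uniformAvg (n + (n + b)) (fun z =>
        (fun x r₁ => A'.pr id (query b n (f x) r₁) {z' | glFun f z' = f x ++ r₁}) (z.take n) (z.drop n)) := by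
    unfold invertProb
    rw [show 2 * n + b = n + (n + b) by ring]
    refine uniformAvg_congr fun z hz => ?_
    have hg : glFun f z = f (z.take n) ++ z.drop n := glFun_eq_of_length hb (by rw [hz]; ring)
    simp only [hg, query]
    rw [show 2 * n + b = n + (n + b) by ring]
  rw [h1, uniformAvg_split n (n + b) (fun x r₁ => A'.pr id (query b n (f x) r₁) {z' | glFun f z' = f x ++ r₁})]
  exact uniformAvg_mono fun x hx => key_le hl hb hx

end Counting

/-! ### Asymptotics: negligible along even and odd lengths -/

/-- `⌊m/2⌋ → ∞`. [folklore] -/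
theorem tendsto_div_two_atTop : Tendsto (fun m : ℕ => m / 2) atTop atTop :=
  tendsto_atTop_atTop.2 fun B => ⟨2 * B, fun m hm => by omega⟩

/-- **Negligible along both parities is negligible.** If `0 ≤ u(2n + b) ≤ v_b(n)` for `b ∈ {0,1}`
and `v₀, v₁ ≥ 0` are negligible, then `u` is negligible: `m^c u(m) ≤ 3^c ⌊m/2⌋^c (v₀ + v₁)(⌊m/2⌋)`
for `m ≥ 2`. [Goldreich 2001, §1.3.5 (negligible functions)] [folklore] -/
theorem superpolynomialDecay_of_halves {u : ℕ → ℝ} {v : ℕ → ℕ → ℝ} (hu0 : ∀ m, 0 ≤ u m)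
    (hv0 : ∀ b n, 0 ≤ v b n) (hle : ∀ n b, b ≤ 1 → u (2 * n + b) ≤ v b n)
    (hv : ∀ b, b ≤ 1 → SuperpolynomialDecay atTop (fun n : ℕ => (n : ℝ)) (v b)) :
    SuperpolynomialDecay atTop (fun m : ℕ => (m : ℝ)) u := by
  intro c
  set g : ℕ → ℝ := fun n => (n : ℝ) ^ c * (v 0 n + v 1 n) with hg_def
  have hg : Tendsto g atTop (nhds 0) := by
    have h := ((hv 0 (by norm_num)) c).add ((hv 1 le_rfl) c)
    rw [add_zero] at h
    refine h.congr' (Eventually.of_forall fun n => ?_)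
    simp only [hg_def]
    ring
  have hbig : Tendsto (fun m : ℕ => (3 : ℝ) ^ c * g (m / 2)) atTop (nhds 0) := by
    simpa using (hg.comp tendsto_div_two_atTop).const_mul ((3 : ℝ) ^ c)
  refine squeeze_zero' (Eventually.of_forall fun m => mul_nonneg (by positivity) (hu0 m)) ?_ hbig
  filter_upwards [eventually_ge_atTop 2] with m hm
  have hdm : 2 * (m / 2) + m % 2 = m := Nat.div_add_mod m 2
  have hb : m % 2 ≤ 1 := by omega
  have hu : u m ≤ v (m % 2) (m / 2) := by
    have h := hle (m / 2) (m % 2) hb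
    rwa [hdm] at h
  have huv : u m ≤ v 0 (m / 2) + v 1 (m / 2) := by
    rcases Nat.mod_two_eq_zero_or_one m with h0 | h1
    · rw [h0] at hu; linarith [hv0 1 (m / 2)]
    · rw [h1] at hu; linarith [hv0 0 (m / 2)]
  have hm3 : (m : ℝ) ≤ 3 * ((m / 2 : ℕ) : ℝ) := by
    have : m ≤ 3 * (m / 2) := by omega
    exact_mod_cast this
  have hpow : (m : ℝ) ^ c ≤ (3 : ℝ) ^ c * ((m / 2 : ℕ) : ℝ) ^ c := by
    rw [← mul_pow]
    exact pow_le_pow_left₀ (by positivity) hm3 c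
  calc (m : ℝ) ^ c * u m ≤ ((3 : ℝ) ^ c * ((m / 2 : ℕ) : ℝ) ^ c) * (v 0 (m / 2) + v 1 (m / 2)) :=
        mul_le_mul hpow huv (hu0 m) (by positivity)
    _ = (3 : ℝ) ^ c * g (m / 2) := by simp only [hg_def]; ring

end GLFunOW

/-! ### The discharge -/

open GLFunOW in
/-- **Discharge of `isOneWay_glFun`** (Goldreich 2001, §2.5.2, remark after Thm. 2.5.2: "Clearly,
`g` is also strongly one-way"): for a length-preserving one-way `f`, `g = glFun f` is
polynomial-time (`glFun_mem_FP`) and every PPT `g`-inverter `A'` has negligible success — its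
success on `U_{2n+b}` is at most that of the PPT `f`-inverter `A_b` on `U_n` (`invertProb_glFun_le`,
`adv_isPPT`), which is negligible by the one-wayness of `f`, for both parities `b`
(`superpolynomialDecay_of_halves`). [cite: Goldreich2001, §2.5.2 (remark after Thm. 2.5.2)] -/
theorem isOneWay_glFun_holds : isOneWay_glFun := by
  intro f hf hl
  refine ⟨glFun_mem_FP hf.1, fun A' hA => ?_⟩
  exact superpolynomialDecay_of_halves (v := fun b n => invertProb f (adv A' b) n)
    (fun m => invertProb_nonneg _ _ m) (fun b n => invertProb_nonneg _ _ n)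
    (fun n b hb => invertProb_glFun_le A' hl hb n) (fun b _ => hf.2 _ (adv_isPPT b hA))

end Literature.Computability.Cryptography
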